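import Literature.NumberTheory.Automorphic.ResGLnConeDictionaryCone
import Summits.Langlands.Langlands.Theorems.IrreducibilityBySelfDualityHeckeEigenvalueFieldStubConeModel
import HarnessLib

/-!
# `GL_n(K)⁺`-equivariance of the cone form — crux HeckeEigenvalueField (stmt-Langlands-13632),
# line Sketch, stub `stub_coneForm_equivariant`

Statement.  Let `K` be a number field, `K_∞ = mixedSpace K`, `G_∞ = GL_n(K_∞)` the archimedean group
of the datum `𝒟 = AutomorphyDatum.gl n K hcpt`, `π = W / W'` an automorphic representation of
`GL_n(𝔸_K)` (`W` a space of automorphic FUNCTIONS), `E = E_λ(ℂ) ⊗ ε_S` the archimedean coefficient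
representation (`ConeDictionary.σS`), and `η` a `(q+1)`-cochain of the `(𝔤, K_∞)`-complex
`ConeDictionary.gkComplexLS π S λ`.  The Borel–Wallach dictionary attaches to `η` and a finite-adelic
point `c` the `E`-valued `(q+1)`-form `ω_c = ConeDictionary.coneForm π S λ η c` on the hermitian space
`ResGLnCone.hermSpace n K`:  `ω_c(H)(v₁, …) = E(g) · η(½ g⁻¹ v₁ g⁻ᴴ, …)(g, c)` for any `g ∈ G_∞` with
`g gᴴ = H`.  For `γ ∈ GL_n(K)⁺ = glTotPos n K`, acting on `H` by `γ • H = γ_∞ H γ_∞ᴴ`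
(`ResGLnCone.coneActionRat`, `γ_∞ = GL_n(ι_∞)(γ)`), on `c` by `γ_f = diagPos n K γ` and on `E` by
`coeffRepPos ℂ n K λ γ`, the family is EQUIVARIANT on the positive cone:
`ω_{γ_f c}(γ • H)(γ • v₁, …) = E_λ(γ) ω_c(H)(v₁, …)`.

Proof [BorelWallach2000, VII 2.2–2.4] (left `G(ℚ)`-equivariance of the de Rham dictionary).
Pick `g ∈ G_∞` with `g gᴴ = H` (transitivity of the cone model, `stub_coneModel`); then
`γ • H = (γ_∞ g)(γ_∞ g)ᴴ`, and by the independence of the section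
(`ConeDictionary.coneForm_eq_of_mul_conjTranspose_eq`) both sides are left-trivialised forms, at
`γ_∞ g` and at `g`.  The trivialised tangent vectors agree,
`(γ_∞ g)⁻¹ · ½ (γ_∞ v γ_∞ᴴ) (γ_∞ g)⁻ᴴ = g⁻¹ · ½ v g⁻ᴴ` (`inv_mul_halfRight_coneAction`), so both sides
evaluate `η` at the SAME element of `∧^{q+1} 𝔤`; the adelic points are related by
`(γ_∞ g, γ_f c) = γ_𝔸 · (g, c)` in `GL_n(𝔸_K)` (`γ_𝔸 = (γ_∞, 1)(1, γ_f)`,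
`HumbertForm.map_algebraMap_eq_ofInfinite_mul_ofFinite`, and `g_∞` commutes with `γ_f`), every
`ψ ∈ W` is left `GL_n(K)`-invariant (`isLeftInvariant_of_mem_automorphicForms`, lifted to `W ⊗ E` by
induction on tensors), and finally `E(γ_∞ g) = E(γ_∞) E(g)` with `(E_λ ⊗ ε_S)(γ_∞) = coeffRepPos γ` on
`GL_n(K)⁺` (`ResGLnCohomology.archCoeffRepSign_diagArchPos`).
-/

set_option linter.dupNamespace false -- project-wide: `Summit.Langlands.Langlands` is the mandated namespace

noncomputable section

open scoped Matrix TensorProduct Classical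
open NumberField NumberField.mixedEmbedding
open Literature.NumberTheory.Automorphic

namespace Summit.Langlands.Langlands.Theorems.HeckeEigenvalueField.Res

open ResGLnCohomology BigHeckeGLn

section Helpers

variable {n : ℕ} {K : Type} [Field K]

/-- Reassociation behind the agreement of the trivialised tangent vectors: for `ui um = 1`,
`gi ui (um V umᴴ (uiᴴ giᴴ)) = gi (V giᴴ)`. [cite: BorelWallach2000, VII 2.2–2.4] -/
private theorem mul_mul_conj_aux (gi ui um V : Matrix (Fin n) (Fin n) (mixedSpace K)) (h : ui * um = 1) :
    gi * ui * (um * V * umᴴ * (uiᴴ * giᴴ)) = gi * (V * giᴴ) := by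
  calc gi * ui * (um * V * umᴴ * (uiᴴ * giᴴ))
      = gi * (ui * um) * V * (ui * um)ᴴ * giᴴ := by
        rw [Matrix.conjTranspose_mul]
        simp only [Matrix.mul_assoc]
    _ = gi * (V * giᴴ) := by
        rw [h, Matrix.conjTranspose_one, Matrix.mul_one, Matrix.mul_one, Matrix.mul_assoc]

/-- **The trivialised tangent vectors agree**: for `u, g ∈ GL_n(K_∞)` and a matrix `V`,
`(u g)⁻¹ · ½ (u V uᴴ) (u g)⁻ᴴ = g⁻¹ · ½ V g⁻ᴴ` — the argument of `η` in `ω_{γ_f c}(γ • H)(γ • v)`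
computed at the root `γ_∞ g` of `γ • H` is the argument of `η` in `ω_c(H)(v)` at the root `g` of `H`.
[cite: BorelWallach2000, VII 2.2–2.4] -/
private theorem inv_mul_halfRight_coneAction (u g : GL (Fin n) (mixedSpace K))
    (V : Matrix (Fin n) (Fin n) (mixedSpace K)) :
    Ring.inverse ((u * g : GL (Fin n) (mixedSpace K)) : Matrix (Fin n) (Fin n) (mixedSpace K)) *
        ((1 / 2 : ℝ) • (((u : Matrix (Fin n) (Fin n) (mixedSpace K)) * V *
          (u : Matrix (Fin n) (Fin n) (mixedSpace K))ᴴ) *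
          (Ring.inverse ((u * g : GL (Fin n) (mixedSpace K)) : Matrix (Fin n) (Fin n) (mixedSpace K)))ᴴ)) =
      Ring.inverse (g : Matrix (Fin n) (Fin n) (mixedSpace K)) *
        ((1 / 2 : ℝ) • (V * (Ring.inverse (g : Matrix (Fin n) (Fin n) (mixedSpace K)))ᴴ)) := by
  rw [Ring.inverse_unit, Ring.inverse_unit, mul_inv_rev, Units.val_mul,
    Matrix.conjTranspose_mul, Matrix.mul_smul, Matrix.mul_smul]
  congr 1
  exact mul_mul_conj_aux _ _ _ V (Units.inv_mul u)

variable [NumberField K]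

/-- **Automorphy on `W ⊗ E`**: the `E`-valued function of a tensor `t ∈ W ⊗ E` is left
`GL_n(K)`-invariant, `t(γ_𝔸 x) = t(x)`, since every `ψ ∈ W ≤ 𝒜` is
(`isLeftInvariant_of_mem_automorphicForms`, Borel–Jacquet 4.2 (a)). [cite: BorelWallach2000, VII 2.2–2.4] -/
theorem evalTensor_toAdelic_mul {hcpt : isCompact_glFiniteIntegralLevel n K}
    (π : AutomorphicRepData (AutomorphyDatum.gl n K hcpt)) {E : Type*} [AddCommGroup E] [Module ℂ E]
    (t : π.W ⊗[ℂ] E) (γ : GL (Fin n) K) (x : (AdelicGroupData.gl n K).Adelic) :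
    π.evalTensor E t ((AdelicGroupData.gl n K).toAdelic γ * x) = π.evalTensor E t x := by
  induction t using TensorProduct.induction_on with
  | zero => simp only [map_zero, Pi.zero_apply]
  | tmul ψ e =>
    rw [AutomorphicRepData.evalTensor_tmul, AutomorphicRepData.evalTensor_tmul,
      isLeftInvariant_of_mem_automorphicForms (π.stable.le_automorphicForms ψ.2) _ ⟨γ, rfl⟩ x]
  | add t t' ht ht' => simp only [map_add, Pi.add_apply, ht, ht']

/-- The adelic point `(γ_∞, γ_f)` of `γ ∈ GL_n(K)` is its diagonal image `γ_𝔸 ∈ GL_n(𝔸_K)`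
(`γ_𝔸 = (γ_∞, 1) · (1, γ_f)`), for any `d ∈ G_∞` over the datum with `d = γ_∞` in `GL_n(𝔸_K)`.
[cite: BorelWallach2000, VII 2.2–2.4] -/
private theorem adelicPt_eq_toAdelic {hcpt : isCompact_glFiniteIntegralLevel n K} (γ : GL (Fin n) K)
    (d : (AutomorphyDatum.gl n K hcpt).arch.carrier)
    (hofd : (AutomorphyDatum.gl n K hcpt).ofArch d = GLn.ofInfinite n K (HumbertForm.ratToMixed K n γ)) :
    ConeDictionary.adelicPt hcpt d (BigHeckeGLn.globalEmbedding n K γ) = (AdelicGroupData.gl n K).toAdelic γ := by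
  rw [ConeDictionary.adelicPt, hofd]
  exact (HumbertForm.map_algebraMap_eq_ofInfinite_mul_ofFinite γ).symm

/-- **The adelic points are related by `γ_𝔸`**: `(γ_∞ g, γ_f c) = γ_𝔸 · (g, c)` in `GL_n(𝔸_K)`
(`g_∞` and `γ_f` commute). [cite: BorelWallach2000, VII 2.2–2.4] -/
private theorem adelicPt_diag_mul {hcpt : isCompact_glFiniteIntegralLevel n K} (γ : glTotPos n K)
    (d g₁ : (AutomorphyDatum.gl n K hcpt).arch.carrier)
    (hofd : (AutomorphyDatum.gl n K hcpt).ofArch d =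
      GLn.ofInfinite n K (HumbertForm.ratToMixed K n (γ : GL (Fin n) K)))
    (c : FiniteAdelicGL n K) :
    ConeDictionary.adelicPt hcpt (d * g₁) (diagPos n K γ * c) =
      (AdelicGroupData.gl n K).toAdelic (γ : GL (Fin n) K) * ConeDictionary.adelicPt hcpt g₁ c := by
  rw [ConeDictionary.adelicPt_mul_right, ConeDictionary.adelicPt_mul,
    show diagPos n K γ = BigHeckeGLn.globalEmbedding n K (γ : GL (Fin n) K) from rfl,
    adelicPt_eq_toAdelic _ d hofd, mul_assoc]
  rfl

/-- **Equivariance of the left form**: `E(γ_∞ g) η(Y)(γ_∞ g, γ_f c) = E_λ(γ) · (E(g) η(Y)(g, c))` for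
`γ ∈ GL_n(K)⁺`, `g ∈ G_∞` and any arguments `Y` — automorphy of `W` under `γ_𝔸`, multiplicativity of
`E` and `(E_λ ⊗ ε_S)(γ_∞) = coeffRepPos γ`; here `d ∈ G_∞` is `γ_∞` over the datum, given through
its two faces `hσd`, `hofd`. [cite: BorelWallach2000, VII 2.2–2.4] -/
theorem leftForm_diag_mul {hcpt : isCompact_glFiniteIntegralLevel n K}
    (π : AutomorphicRepData (AutomorphyDatum.gl n K hcpt))
    (S : Finset {w : InfinitePlace K // w.IsReal}) (lam : (K →+* ℂ) → Fin n → ℤ) {q : ℕ}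
    (η : ConeDictionary.Cochain π lam q) (γ : glTotPos n K) (c : FiniteAdelicGL n K)
    (d g₁ : (AutomorphyDatum.gl n K hcpt).arch.carrier)
    (hσd : ConeDictionary.σS hcpt S lam d = coeffRepPos ℂ n K lam γ)
    (hofd : (AutomorphyDatum.gl n K hcpt).ofArch d =
      GLn.ofInfinite n K (HumbertForm.ratToMixed K n (γ : GL (Fin n) K)))
    (Y : Fin q → Matrix (Fin n) (Fin n) (mixedSpace K)) :
    ConeDictionary.leftForm π S lam η (diagPos n K γ * c)
        (((d * g₁ : (AutomorphyDatum.gl n K hcpt).arch.carrier) : GL (Fin n) (mixedSpace K)) :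
          Matrix (Fin n) (Fin n) (mixedSpace K)) Y =
      coeffRepPos ℂ n K lam γ (ConeDictionary.leftForm π S lam η c
        (((g₁ : (AutomorphyDatum.gl n K hcpt).arch.carrier) : GL (Fin n) (mixedSpace K)) :
          Matrix (Fin n) (Fin n) (mixedSpace K)) Y) := by
  rw [ConeDictionary.leftForm_apply, ConeDictionary.leftForm_apply, ConeDictionary.archOfMatrix_coe_datum,
    ConeDictionary.archOfMatrix_coe_datum, ConeDictionary.leftFormAlg_apply, ConeDictionary.leftFormAlg_apply,
    ConeDictionary.twistedEval_apply, ConeDictionary.twistedEval_apply, map_mul (ConeDictionary.σS hcpt S lam) d g₁,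
    Module.End.mul_apply, adelicPt_diag_mul γ d g₁ hofd c, evalTensor_toAdelic_mul, hσd]

end Helpers

/-- **Stub (b2) EQUIVARIANCE of the cone form under `GL_n(K)⁺`**: for `γ ∈ GL_n(K)⁺`, a cochain `η`
of the `(𝔤, K_∞)`-complex, a finite-adelic point `c` and `H` in the positive cone,
`ω_{γ_f c}(γ • H)(γ • v₁, …, γ • v_{q+1}) = E_λ(γ) ω_c(H)(v₁, …, v_{q+1})`.  Proof: with `H = g gᴴ`
(`stub_coneModel`), `γ • H = (γ_∞ g)(γ_∞ g)ᴴ` and section independence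
(`ConeDictionary.coneForm_eq_of_mul_conjTranspose_eq`) at the roots `g` and `γ_∞ g`; the trivialised
tangent vectors agree (`inv_mul_halfRight_coneAction`); the left form is equivariant
(`leftForm_diag_mul`: automorphy of `W`, `(γ_∞ g, γ_f c) = γ_𝔸 (g, c)`, `E(γ_∞ g) = E_λ(γ) E(g)`).
[cite: BorelWallach2000, VII 2.2–2.4] -/
theorem stub_coneForm_equivariant {n : ℕ} {K : Type} [Field K] [NumberField K]
    (hcpt : isCompact_glFiniteIntegralLevel n K) (π : AutomorphicRepData (AutomorphyDatum.gl n K hcpt))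
    (S : Finset {w : InfinitePlace K // w.IsReal}) (lam : (K →+* ℂ) → Fin n → ℤ) {q : ℕ}
    {η : ConeDictionary.Cochain π lam (q + 1)}
    (hη : η ∈ (ConeDictionary.gkComplexLS π S lam).carrier (q + 1))
    (γ : glTotPos n K) (c : FiniteAdelicGL n K) {H : ResGLnCone.hermSpace n K}
    (hH : H ∈ ResGLnCone.posCone n K) (v : Fin (q + 1) → ResGLnCone.hermSpace n K) :
    ConeDictionary.coneForm π S lam η (diagPos n K γ * c)
        (ResGLnCone.coneActionRat n K (γ : GL (Fin n) K) H)
        (fun j => ResGLnCone.coneActionRat n K (γ : GL (Fin n) K) (v j)) =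
      coeffRepPos ℂ n K lam γ (ConeDictionary.coneForm π S lam η c H v) := by
  -- a square root `g₁ ∈ G_∞` of `H` (transitivity of the cone model)
  obtain ⟨g₁, hg⟩ : ∃ g₁ : (AutomorphyDatum.gl n K hcpt).arch.carrier,
      (((g₁ : (AutomorphyDatum.gl n K hcpt).arch.carrier) : GL (Fin n) (mixedSpace K)) :
          Matrix (Fin n) (Fin n) (mixedSpace K)) *
        ((((g₁ : (AutomorphyDatum.gl n K hcpt).arch.carrier) : GL (Fin n) (mixedSpace K)) :
          Matrix (Fin n) (Fin n) (mixedSpace K)))ᴴ = (H : Matrix (Fin n) (Fin n) (mixedSpace K)) := by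
    obtain ⟨g, hg⟩ := (stub_coneModel n K).1 (H : Matrix (Fin n) (Fin n) (mixedSpace K)) hH.1 hH.2
    exact ⟨⟨g, Subgroup.mem_top _⟩, hg⟩
  -- `γ_∞ ∈ G_∞` over the datum (`diagArchPos γ`), through its three faces
  obtain ⟨d, hdU, hσd, hofd⟩ : ∃ d : (AutomorphyDatum.gl n K hcpt).arch.carrier,
      (d : GL (Fin n) (mixedSpace K)) = ResGLnCone.toMixedGL n K (γ : GL (Fin n) K) ∧
      ConeDictionary.σS hcpt S lam d = coeffRepPos ℂ n K lam γ ∧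
      (AutomorphyDatum.gl n K hcpt).ofArch d =
        GLn.ofInfinite n K (HumbertForm.ratToMixed K n (γ : GL (Fin n) K)) :=
    ⟨ResGLnCohomology.diagArchPos n K γ, rfl, ResGLnCohomology.archCoeffRepSign_diagArchPos n K S lam γ, rfl⟩
  -- `γ_∞ g₁` is a square root of `γ • H`
  have hg₂ : (((d * g₁ : (AutomorphyDatum.gl n K hcpt).arch.carrier) : GL (Fin n) (mixedSpace K)) :
          Matrix (Fin n) (Fin n) (mixedSpace K)) *
        ((((d * g₁ : (AutomorphyDatum.gl n K hcpt).arch.carrier) : GL (Fin n) (mixedSpace K)) :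
          Matrix (Fin n) (Fin n) (mixedSpace K)))ᴴ =
      ((ResGLnCone.coneActionRat n K (γ : GL (Fin n) K) H : ResGLnCone.hermSpace n K) :
        Matrix (Fin n) (Fin n) (mixedSpace K)) := by
    rw [ResGLnCone.coneActionRat_apply, ResGLnCone.coe_coneAction, ← hdU, ← hg, Subgroup.coe_mul, Units.val_mul,
      Matrix.conjTranspose_mul]
    simp only [Matrix.mul_assoc]
  -- section independence on both sides, equivariance of the left form
  rw [ConeDictionary.coneForm_eq_of_mul_conjTranspose_eq π S lam hη c g₁ hg,
    ConeDictionary.coneForm_eq_of_mul_conjTranspose_eq π S lam hη (diagPos n K γ * c) (d * g₁) hg₂,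
    ContinuousAlternatingMap.compContinuousLinearMap_apply, ContinuousAlternatingMap.compContinuousLinearMap_apply,
    ConeDictionary.leftTrivForm_apply, ConeDictionary.leftTrivForm_apply,
    ← leftForm_diag_mul π S lam η γ c d g₁ hσd hofd]
  -- the trivialised tangent vectors agree: `(γ_∞ g)⁻¹ · ½ (γ • vᵢ) (γ_∞ g)⁻ᴴ = g⁻¹ · ½ vᵢ g⁻ᴴ`
  congr 1
  funext i
  rw [Function.comp_apply, Function.comp_apply, ConeDictionary.halfRight_apply, ConeDictionary.halfRight_apply,
    ResGLnCone.coneActionRat_apply, ResGLnCone.coe_coneAction, ← hdU, Subgroup.coe_mul]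
  exact inv_mul_halfRight_coneAction _ _ _

end Summit.Langlands.Langlands.Theorems.HeckeEigenvalueField.Res

end
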